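import Summits.QuantumFields.GaugeBoot.Targets
import Literature.MathematicalPhysics.QuantumLattice.SU2Haar
import Mathlib.GroupTheory.FreeGroup.Basic
import HarnessLib

/-!
# Every pair in `SU(2)` is simultaneously conjugate to the pair of inverses; Fricke–Klein–Horowitz
# invariance of two-generator trace functions (gauge-boot, large-`N` supplement 17, part 1)

HONEST FRAMING (cell `pub-gaugeboot`, page 1 of every file): the venture produces certified bounds
on lattice expectations at stated coupling, gauge group, dimension and torus size; NOT a mass gap,
NOT a continuum limit, NOT a string tension; NOT large `N` unless marked CONDITIONAL; NOT
Yang–Mills-summit-bearing (barriers `FixedCouplingUltralocality`, `PerturbativeInvisibility`).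
Pure group theory; this file certifies no number.  It is the algebraic kernel of
`SU2LoopPairInversion.lean` (part 2): over `SU(2)` the loop variables of `w(p, q)` and `w(p⁻¹, q⁻¹)`
coincide for EVERY word `w` in two based loops `p, q` — an exact, coupling-independent identity between
loop classes that the lattice-symmetry canon (`LoopClasses`) keeps apart.

## Content

* `mul_self_eq_neg_one` — a `2 × 2` matrix of determinant `1` and trace `0` squares to `-1`
  (Cayley–Hamilton); `conj_eq_inv_of_sq_eq` — in any group, `(gx)² = g²` forces `g x g⁻¹ = x⁻¹`;
  hence ★ `conj_eq_inv_of_trace_zero`: for `g, x ∈ SU(2)` with `tr g = tr (g x) = 0`, `g x g⁻¹ = x⁻¹`.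
* ★ `exists_traceless_orthogonal` — for every `A, B ∈ SU(2)` there is `g ∈ SU(2)` with
  `tr g = tr (gA) = tr (gB) = 0`: the unit quaternion perpendicular to `1`, to the axis of `A` and to
  the axis of `B` (three real-linear conditions on `ℍ ≅ ℝ⁴`, `Quaternion.finrank_eq_four`,
  `LinearMap.ker_ne_bot_of_finrank_lt`; the lane's quaternion model `SU2Haar.quatMatrix / quatToSU2`).
* ★★ `exists_conj_eq_inv_pair` — **every pair `(A, B)` in `SU(2)` is simultaneously conjugate to
  `(A⁻¹, B⁻¹)`** (rotation by `π` about the common perpendicular of the two axes);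
  ★★ `exists_lift_inv_eq_conj` — for `f : Fin 2 → SU(2)` ONE `g` conjugates `w(f)` to `w(f⁻¹)` for
  every `w ∈ F₂` (`FreeGroup.lift`, `FreeGroup.ext_hom`);
  ★★★ `trace_lift_inv` — **`tr w(A⁻¹, B⁻¹) = tr w(A, B)` for all `A, B ∈ SU(2)` and all `w ∈ F₂`**.
* SHARPNESS: `trace_three_ne` — three generators fail (`A, B, C = i, j, k`: `tr(ijk) = -2`,
  `tr(i⁻¹j⁻¹k⁻¹) = 2`); pairs in `SU(3)` fail (part 3, `SU3LoopTraceIdentity.lean`, explicit pair).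

In print: Fricke–Klein (trace of `w(A,B)`, `A, B ∈ SL(2)`, is a polynomial in `tr A, tr B, tr AB`);
Horowitz, Comm. Pure Appl. Math. 25 (1972) 635–649; Kapovich–Levitt–Schupp–Shpilrain, Trans. AMS 359
(2007), arXiv:math/0409284, Prop. 5.3 (`tr w(A,B) = tr w(A⁻¹,B⁻¹) = tr w^R(A,B)` on `SL(2, K)`, via the
trace polynomial).  The proof here is different and specific to `SU(2)`: simultaneous conjugacy by an
explicit traceless element, so that not only the traces but the HOLONOMIES are conjugate, uniformly in
`w`.  Mathlib has `FreeGroup.lift` and quaternions; it has no Fricke characters.  [folklore]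
-/

noncomputable section

open Matrix
open Literature.MathematicalPhysics.QuantumLattice (quatMatrix quatMatrix_mul su2Quat quatMatrix_su2Quat
  quatToSU2 coe_quatToSU2 quatMatrix_apply_00 quatMatrix_apply_11)

namespace Summit.QuantumFields.GaugeBoot

namespace SU2PairInversion

/-! ## Traceless elements of `SL(2)` square to `-1`; a group lemma -/

/-- **Cayley–Hamilton for a traceless `2 × 2` matrix of determinant one: `M² = -1`.** [folklore] -/
theorem mul_self_eq_neg_one {R : Type*} [CommRing R] {M : Matrix (Fin 2) (Fin 2) R}
    (hdet : M.det = 1) (htr : M.trace = 0) : M * M = -1 := by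
  rw [Matrix.det_fin_two] at hdet
  rw [Matrix.trace_fin_two] at htr
  ext i j
  fin_cases i <;> fin_cases j
  · simp [Matrix.mul_apply, Fin.sum_univ_two]
    linear_combination (M 0 0) * htr - hdet
  · simp [Matrix.mul_apply, Fin.sum_univ_two]
    linear_combination (M 0 1) * htr
  · simp [Matrix.mul_apply, Fin.sum_univ_two]
    linear_combination (M 1 0) * htr
  · simp [Matrix.mul_apply, Fin.sum_univ_two]
    linear_combination (M 1 1) * htr - hdet

/-- In any group: if `(g x)² = g²` then `g x g⁻¹ = x⁻¹` (cancel `g`, read `x g x = g`). [folklore] -/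
theorem conj_eq_inv_of_sq_eq {G : Type*} [Group G] {g x : G} (h : (g * x) * (g * x) = g * g) :
    g * x * g⁻¹ = x⁻¹ := by
  rw [mul_assoc] at h
  have h1 : x * (g * x) = g := mul_left_cancel h
  have h2 : g * x = x⁻¹ * g := eq_inv_mul_iff_mul_eq.mpr h1
  rw [h2, mul_inv_cancel_right]

/-! ## `SU(2)`: traceless `g` with traceless `g x` inverts `x` by conjugation -/

/-- For `g, x ∈ SU(2)` with `tr g = 0` and `tr (g x) = 0`: `(g x)² = g²` (both are `-1`). [folklore] -/
theorem sq_eq_sq_of_trace_zero (g x : SU 2) (hg : (g : Matrix (Fin 2) (Fin 2) ℂ).trace = 0)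
    (hgx : ((g : Matrix (Fin 2) (Fin 2) ℂ) * x).trace = 0) : (g * x) * (g * x) = g * g := by
  apply Subtype.ext
  have hdg : (g : Matrix (Fin 2) (Fin 2) ℂ).det = 1 := (Matrix.mem_specialUnitaryGroup_iff.1 g.2).2
  have hdgx : ((g : Matrix (Fin 2) (Fin 2) ℂ) * x).det = 1 := (Matrix.mem_specialUnitaryGroup_iff.1 (g * x).2).2
  show (g : Matrix (Fin 2) (Fin 2) ℂ) * x * ((g : Matrix (Fin 2) (Fin 2) ℂ) * x) = (g : Matrix (Fin 2) (Fin 2) ℂ) * g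
  rw [mul_self_eq_neg_one hdg hg, mul_self_eq_neg_one hdgx hgx]

/-- ★ **For `g, x ∈ SU(2)` with `tr g = tr (g x) = 0`: `g x g⁻¹ = x⁻¹`.** [folklore] -/
theorem conj_eq_inv_of_trace_zero (g x : SU 2) (hg : (g : Matrix (Fin 2) (Fin 2) ℂ).trace = 0)
    (hgx : ((g : Matrix (Fin 2) (Fin 2) ℂ) * x).trace = 0) : g * x * g⁻¹ = x⁻¹ :=
  conj_eq_inv_of_sq_eq (sq_eq_sq_of_trace_zero g x hg hgx)

/-! ## Existence of the conjugator: the common perpendicular (quaternion model) -/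

/-- `tr (quatMatrix q) = 2 Re q`. [folklore] -/
theorem trace_quatMatrix (q : Quaternion ℝ) : (quatMatrix q).trace = ((2 * q.re : ℝ) : ℂ) := by
  rw [Matrix.trace_fin_two, quatMatrix_apply_00, quatMatrix_apply_11]
  apply Complex.ext <;> simp [two_mul]

/-- ★ **For every `A, B ∈ SU(2)` there is `g ∈ SU(2)` with `tr g = tr (g A) = tr (g B) = 0`**: a unit
quaternion orthogonal to `1`, `Ā` and `B̄` exists because three real-linear functionals on the
four-dimensional `ℍ` have a common non-zero kernel vector. [folklore] -/
theorem exists_traceless_orthogonal (A B : SU 2) : ∃ g : SU 2, (g : Matrix (Fin 2) (Fin 2) ℂ).trace = 0 ∧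
    ((g : Matrix (Fin 2) (Fin 2) ℂ) * A).trace = 0 ∧ ((g : Matrix (Fin 2) (Fin 2) ℂ) * B).trace = 0 := by
  set qa := su2Quat A with hqa
  set qb := su2Quat B with hqb
  let f : Quaternion ℝ →ₗ[ℝ] (Fin 3 → ℝ) :=
    { toFun := fun q => ![q.re, (q * qa).re, (q * qb).re]
      map_add' := fun p q => by
        ext i; fin_cases i <;> simp [add_mul]
      map_smul' := fun c q => by
        ext i; fin_cases i <;> simp }
  have hker : LinearMap.ker f ≠ ⊥ :=
    LinearMap.ker_ne_bot_of_finrank_lt (by rw [Module.finrank_fin_fun, Quaternion.finrank_eq_four]; norm_num)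
  obtain ⟨q, hq, hq0⟩ := (Submodule.ne_bot_iff _).1 hker
  have hfq : f q = 0 := LinearMap.mem_ker.1 hq
  have hre : q.re = 0 := by simpa [f] using congr_fun hfq 0
  have hra : (q * qa).re = 0 := by simpa [f] using congr_fun hfq 1
  have hrb : (q * qb).re = 0 := by simpa [f] using congr_fun hfq 2
  refine ⟨quatToSU2 q, ?_, ?_, ?_⟩
  · rw [coe_quatToSU2 hq0, trace_quatMatrix, Quaternion.re_smul, hre]
    simp
  · rw [coe_quatToSU2 hq0, ← quatMatrix_su2Quat A, ← hqa, ← quatMatrix_mul, trace_quatMatrix,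
      smul_mul_assoc, Quaternion.re_smul, hra]
    simp
  · rw [coe_quatToSU2 hq0, ← quatMatrix_su2Quat B, ← hqb, ← quatMatrix_mul, trace_quatMatrix,
      smul_mul_assoc, Quaternion.re_smul, hrb]
    simp

/-- ★★ **Every pair in `SU(2)` is simultaneously conjugate to the pair of inverses**: for all
`A, B ∈ SU(2)` there is `g ∈ SU(2)` with `g A g⁻¹ = A⁻¹` and `g B g⁻¹ = B⁻¹` (the rotation by `π`
about the common perpendicular of the axes of `A` and `B`). [folklore] -/
theorem exists_conj_eq_inv_pair (A B : SU 2) : ∃ g : SU 2, g * A * g⁻¹ = A⁻¹ ∧ g * B * g⁻¹ = B⁻¹ := by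
  obtain ⟨g, hg, hgA, hgB⟩ := exists_traceless_orthogonal A B
  exact ⟨g, conj_eq_inv_of_trace_zero g A hg hgA, conj_eq_inv_of_trace_zero g B hg hgB⟩

/-- The same for a `Fin 2`-indexed family. [folklore] -/
theorem exists_conj_eq_inv_family (f : Fin 2 → SU 2) : ∃ g : SU 2, ∀ i, g * f i * g⁻¹ = (f i)⁻¹ := by
  obtain ⟨g, h0, h1⟩ := exists_conj_eq_inv_pair (f 0) (f 1)
  refine ⟨g, fun i => ?_⟩
  fin_cases i
  · exact h0
  · exact h1

/-! ## All words at once: `w(A⁻¹, B⁻¹) = g · w(A, B) · g⁻¹` -/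

/-- ★★ **One conjugator for all words**: for `f : Fin 2 → SU(2)` there is `g ∈ SU(2)` with
`w(f⁻¹) = g w(f) g⁻¹` for every `w ∈ F₂` (two homomorphisms `F₂ → SU(2)` agreeing on the generators).
[folklore] -/
theorem exists_lift_inv_eq_conj (f : Fin 2 → SU 2) : ∃ g : SU 2, ∀ w : FreeGroup (Fin 2),
    FreeGroup.lift (fun i => (f i)⁻¹) w = g * FreeGroup.lift f w * g⁻¹ := by
  obtain ⟨g, hg⟩ := exists_conj_eq_inv_family f
  refine ⟨g, fun w => ?_⟩
  have hφ : FreeGroup.lift (fun i => (f i)⁻¹) = (MulAut.conj g).toMonoidHom.comp (FreeGroup.lift f) := by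
    refine FreeGroup.ext_hom _ _ fun i => ?_
    rw [FreeGroup.lift_apply_of, MonoidHom.comp_apply, FreeGroup.lift_apply_of]
    exact (hg i).symm
  rw [hφ]
  rfl

/-- Conjugation does not change the trace (`SU(2)`, unitarity `g⋆ g = 1`). [folklore] -/
theorem trace_coe_conj (g h : SU 2) :
    ((g * h * g⁻¹ : SU 2) : Matrix (Fin 2) (Fin 2) ℂ).trace = (h : Matrix (Fin 2) (Fin 2) ℂ).trace := by
  have hu : star (g : Matrix (Fin 2) (Fin 2) ℂ) * g = 1 :=
    Matrix.mem_unitaryGroup_iff'.1 (Matrix.mem_specialUnitaryGroup_iff.1 g.2).1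
  show ((g : Matrix (Fin 2) (Fin 2) ℂ) * h * star (g : Matrix (Fin 2) (Fin 2) ℂ)).trace = (h : Matrix (Fin 2) (Fin 2) ℂ).trace
  rw [Matrix.trace_mul_cycle, hu, one_mul]

/-- ★★★ **Fricke–Klein–Horowitz invariance for `SU(2)`: `tr w(A⁻¹, B⁻¹) = tr w(A, B)` for every
`A, B ∈ SU(2)` and every `w ∈ F₂`** (family form `f : Fin 2 → SU(2)`).  In print for `SL(2, K)` via the
trace polynomial (Kapovich–Levitt–Schupp–Shpilrain 2007, Prop. 5.3; Horowitz 1972); here from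
`exists_lift_inv_eq_conj`. [folklore] -/
theorem trace_lift_inv (f : Fin 2 → SU 2) (w : FreeGroup (Fin 2)) :
    ((FreeGroup.lift (fun i => (f i)⁻¹) w : SU 2) : Matrix (Fin 2) (Fin 2) ℂ).trace =
      ((FreeGroup.lift f w : SU 2) : Matrix (Fin 2) (Fin 2) ℂ).trace := by
  obtain ⟨g, hg⟩ := exists_lift_inv_eq_conj f
  rw [hg w, trace_coe_conj]

/-- ★★★ The two-matrix form: `tr w(A⁻¹, B⁻¹) = tr w(A, B)` (`w ∈ F₂`, generators `0 ↦ A`, `1 ↦ B`).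
[folklore] -/
theorem trace_lift_inv_pair (A B : SU 2) (w : FreeGroup (Fin 2)) :
    ((FreeGroup.lift ![A⁻¹, B⁻¹] w : SU 2) : Matrix (Fin 2) (Fin 2) ℂ).trace =
      ((FreeGroup.lift ![A, B] w : SU 2) : Matrix (Fin 2) (Fin 2) ℂ).trace := by
  have h : (![A⁻¹, B⁻¹] : Fin 2 → SU 2) = fun i => (![A, B] i)⁻¹ := by
    funext i; fin_cases i <;> rfl
  rw [h]
  exact trace_lift_inv ![A, B] w

/-- The list form (Mathlib's `FreeGroup.mk`): inverting every letter's generator, KEEPING the order of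
the letters, does not change the trace over `SU(2)`. [folklore] -/
theorem trace_prod_map_inv (f : Fin 2 → SU 2) (L : List (Fin 2 × Bool)) :
    (((L.map fun x => cond x.2 (f x.1)⁻¹ (f x.1)⁻¹⁻¹).prod : SU 2) : Matrix (Fin 2) (Fin 2) ℂ).trace =
      (((L.map fun x => cond x.2 (f x.1) (f x.1)⁻¹).prod : SU 2) : Matrix (Fin 2) (Fin 2) ℂ).trace := by
  have h := trace_lift_inv f (FreeGroup.mk L)
  simpa only [FreeGroup.lift_mk] using h

/-! ## Sharpness: three generators -/

/-- **SHARPNESS — three generators**: simultaneous inversion is NOT a trace symmetry for three elements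
of `SU(2)`: with the unit quaternions `i = diag(i, -i)`, `j = [[0,1],[-1,0]]`, `k = [[0,i],[i,0]]`,
`tr(ijk) = -2 ≠ 2 = tr(i⁻¹j⁻¹k⁻¹)`. [folklore] -/
theorem trace_three_ne : ∃ A B C : SU 2,
    ((A * B * C : SU 2) : Matrix (Fin 2) (Fin 2) ℂ).trace ≠ ((A⁻¹ * B⁻¹ * C⁻¹ : SU 2) : Matrix (Fin 2) (Fin 2) ℂ).trace := by
  have hI : !![Complex.I, 0; 0, -Complex.I] ∈ Matrix.specialUnitaryGroup (Fin 2) ℂ := by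
    rw [Matrix.mem_specialUnitaryGroup_iff, Matrix.mem_unitaryGroup_iff]
    refine ⟨?_, by simp [Matrix.det_fin_two]⟩
    ext i j
    fin_cases i <;> fin_cases j <;> simp [Matrix.mul_apply, Fin.sum_univ_two, Matrix.star_apply]
  have hJ : !![(0 : ℂ), 1; -1, 0] ∈ Matrix.specialUnitaryGroup (Fin 2) ℂ := by
    rw [Matrix.mem_specialUnitaryGroup_iff, Matrix.mem_unitaryGroup_iff]
    refine ⟨?_, by simp [Matrix.det_fin_two]⟩
    ext i j
    fin_cases i <;> fin_cases j <;> simp [Matrix.mul_apply, Fin.sum_univ_two, Matrix.star_apply]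
  have hK : !![0, Complex.I; Complex.I, 0] ∈ Matrix.specialUnitaryGroup (Fin 2) ℂ := by
    rw [Matrix.mem_specialUnitaryGroup_iff, Matrix.mem_unitaryGroup_iff]
    refine ⟨?_, by simp [Matrix.det_fin_two]⟩
    ext i j
    fin_cases i <;> fin_cases j <;> simp [Matrix.mul_apply, Fin.sum_univ_two, Matrix.star_apply]
  refine ⟨⟨_, hI⟩, ⟨_, hJ⟩, ⟨_, hK⟩, ?_⟩
  have h1 : (!![Complex.I, 0; 0, -Complex.I] * !![(0 : ℂ), 1; -1, 0] * !![0, Complex.I; Complex.I, 0]).trace = -2 := by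
    rw [Matrix.trace_fin_two]
    simp [Matrix.mul_apply, Fin.sum_univ_two]
    norm_num
  have h2 : (star !![Complex.I, 0; 0, -Complex.I] * star !![(0 : ℂ), 1; -1, 0] * star !![0, Complex.I; Complex.I, 0]).trace = 2 := by
    rw [Matrix.trace_fin_two]
    simp [Matrix.mul_apply, Fin.sum_univ_two, Matrix.star_apply]
    norm_num
  show (!![Complex.I, 0; 0, -Complex.I] * !![(0 : ℂ), 1; -1, 0] * !![0, Complex.I; Complex.I, 0]).trace ≠
    (star !![Complex.I, 0; 0, -Complex.I] * star !![(0 : ℂ), 1; -1, 0] * star !![0, Complex.I; Complex.I, 0]).trace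
  rw [h1, h2]
  norm_num

end SU2PairInversion

end Summit.QuantumFields.GaugeBoot

end
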